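import Literature.NumberTheory.Automorphic.CartanDecompositionGLn
import Literature.NumberTheory.Automorphic.IwasawaDecompositionGL
import Literature.NumberTheory.Automorphic.TamagawaHeckeSeries
import Mathlib.Data.Fin.Tuple.Sort
import HarnessLib

/-!
# The Cartan decomposition `GL_n(F) = ⨆_a GL_n(𝒪) ϖ^a GL_n(𝒪)` with sorted exponents

Topic `NumberTheory/Automorphic`; theorems only (no definition, no named fact), on top of
`CartanDecompositionGLn` (Smith normal form over a PID, the diagonal form of the Cartan
decomposition), `IwasawaDecompositionGL` (`zpowDiagGL`, factorisation `x = ϖ^a e`) and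
`TamagawaHeckeSeries` (`glIntDet n ϖ m = Δ_m`).  Setting: a field `F` with a `ValuativeRel` whose
valuation ring `𝒪 = 𝒪[F]` is a discrete valuation ring (automatic for a non-archimedean local
field), a uniformizing element `ϖ` (`IsUniformizingElement`, `HeckeTransversalGL`; one exists,
`exists_isUniformizingElement`), `K = GL_n(𝒪) = glInt n F`.

* `exists_glInt_mul_mul_eq_piPowGL` (**Cartan decomposition, integral form**; elementary
  divisors): for an integral `g ∈ GL_n(F)` there are `k₁, k₂ ∈ K` and exponents
  `a_1 ≥ a_2 ≥ ⋯ ≥ a_n ≥ 0` (`Antitone a`) with `k₁ g k₂ = ϖ^a = diag(ϖ^{a_1}, …, ϖ^{a_n})`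
  (`piPowGL`): Smith normal form over `𝒪`
  (`Matrix.exists_eq_mul_diagonal_mul_of_mulVec_injective`), the units absorbed into `K`
  (`diagonalGL_mem_glInt`) and the exponents sorted by a permutation matrix
  (`permGL_mul_piPowGL_mul_inv`).  With determinants, the double cosets `K g K ⊆ Δ_m` are the
  `K ϖ^a K` with `a` antitone and `∑ a_i = m` (`exists_glInt_mul_mul_eq_piPowGL_of_mem_glIntDet`,
  `piPowGL_mem_glIntDet`, `sum_eq_of_piPowGL_mem_glIntDet`).
* `exists_glInt_mul_mul_eq_zpowDiagGL` (**general form**): every `g ∈ GL_n(F)` has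
  `k₁ g k₂ = ϖ^a` with `a ∈ ℤⁿ` antitone, after scaling `g` into the integral matrices by a
  central power of `ϖ` (`exists_zpowDiagGL_mul_isIntegralMatrix`, `mul_zpowDiagGL_const_comm`).

This is the Cartan decomposition `G = K A⁻ K` for `GL_n` as used in the Satake isomorphism
(Cartier, *Representations of 𝔭-adic groups*, Corvallis 1979, §IV.2, Example `GL_n`; Macdonald,
*Symmetric functions and Hall polynomials*, Ch. V, (2.2); Bump (1997), Prop. 4.6.2; Shimura
(1971), §3.2, the `T(p^{a_1}, …, p^{a_n})`).

## References

* P. Cartier, *Representations of 𝔭-adic groups: a survey*, Proc. Sympos. Pure Math. 33 (1979),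
  part 1, §IV.2 [CartierCorvallis1979].
* I. G. Macdonald, *Symmetric functions and Hall polynomials*, 2nd ed. (1995), Ch. V, §2, (2.2)
  [Macdonald1995].
* D. Bump, *Automorphic Forms and Representations* (1997), Prop. 4.6.2 [Bump1997].
* G. Shimura, *Introduction to the arithmetic theory of automorphic functions* (1971), §3.2
  [ShimuraIATAF1971].
-/

noncomputable section

open scoped Pointwise MatrixGroups
open MulAction ValuativeRel Matrix

namespace Literature.NumberTheory.Automorphic

variable {F : Type*} [Field F] [ValuativeRel F] {n : ℕ}

/-! ### Uniformizing elements exist -/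

/-- The valuation ring of a field whose valuation ring is a discrete valuation ring (e.g. a
non-archimedean local field) has a uniformizing element. [folklore] -/
theorem exists_isUniformizingElement [IsDiscreteValuationRing 𝒪[F]] :
    ∃ ϖ : F, IsUniformizingElement ϖ := by
  obtain ⟨ϖ, hϖ⟩ := IsDiscreteValuationRing.exists_irreducible 𝒪[F]
  refine ⟨ϖ, ⟨ϖ.2, fun h => hϖ.ne_zero (Subtype.ext h), ?_⟩⟩
  rw [(IsDiscreteValuationRing.irreducible_iff_uniformizer _).mp hϖ]

/-! ### Central powers of `ϖ` -/

section Central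

variable {ϖ : F} (hϖ : ϖ ≠ 0)

omit [ValuativeRel F] in
/-- The matrix of `ϖ^{(c, …, c)}` is the scalar matrix `ϖ^c · 1`. [folklore] -/
theorem coe_zpowDiagGL_const (c : ℤ) :
    ((zpowDiagGL hϖ (fun _ : Fin n => c) : GL (Fin n) F) : Matrix (Fin n) (Fin n) F) =
      Matrix.scalar (Fin n) (ϖ ^ c) := by
  rw [coe_zpowDiagGL, Matrix.scalar_apply]

omit [ValuativeRel F] in
/-- `ϖ^{(c, …, c)} = ϖ^c · 1` is central in `GL_n(F)`. [folklore] -/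
theorem mul_zpowDiagGL_const_comm (c : ℤ) (x : GL (Fin n) F) :
    x * zpowDiagGL hϖ (fun _ : Fin n => c) = zpowDiagGL hϖ (fun _ : Fin n => c) * x := by
  refine Units.ext ?_
  rw [Units.val_mul, Units.val_mul, coe_zpowDiagGL_const]
  exact ((Matrix.scalar_commute (ϖ ^ c) (fun r' => mul_comm _ r')
    (x : Matrix (Fin n) (Fin n) F))).symm.eq

omit [ValuativeRel F] in
/-- Entries of `ϖ^{(c, …, c)} x` are `ϖ^c x_{ij}`. [folklore] -/
theorem zpowDiagGL_const_mul_apply (c : ℤ) (x : GL (Fin n) F) (i j : Fin n) :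
    ((zpowDiagGL hϖ (fun _ : Fin n => c) * x : GL (Fin n) F) : Matrix (Fin n) (Fin n) F) i j =
      ϖ ^ c * (x : Matrix (Fin n) (Fin n) F) i j := by
  rw [Units.val_mul, coe_zpowDiagGL_const, Matrix.scalar_apply, Matrix.diagonal_mul]

end Central

/-! ### Scaling into integral matrices -/

section Scaling

variable [IsDiscreteValuationRing 𝒪[F]] {ϖ : F} (hϖ : IsUniformizingElement ϖ)
include hϖ

/-- Every `x ∈ F` becomes integral after multiplication by a power of `ϖ`. [folklore] -/
theorem exists_pow_mul_mem (x : F) : ∃ N : ℕ, ∀ M : ℕ, N ≤ M → ϖ ^ M * x ∈ 𝒪[F] := by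
  by_cases hx : x = 0
  · exact ⟨0, fun M _ => by rw [hx, mul_zero]; exact Subring.zero_mem _⟩
  obtain ⟨a, e, he, rfl⟩ := exists_eq_zpow_mul_of_ne_zero hϖ hx
  refine ⟨(-a).toNat, fun M hM => ?_⟩
  rw [← mul_assoc, ← zpow_natCast, ← zpow_add₀ hϖ.ne_zero]
  have hMa : 0 ≤ (M : ℤ) + a := by have := Int.self_le_toNat (-a); omega
  refine Subring.mul_mem _ ?_ ((Valuation.mem_integer_iff _ _).mpr he.le)
  obtain ⟨b, hb⟩ := Int.eq_ofNat_of_zero_le hMa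
  rw [hb, zpow_natCast]
  exact hϖ.pow_mem b

/-- Every `g ∈ GL_n(F)` becomes an integral matrix after multiplication by a central power of `ϖ`.
[folklore] -/
theorem exists_zpowDiagGL_mul_isIntegralMatrix (g : GL (Fin n) F) :
    ∃ N : ℕ, IsIntegralMatrix ((zpowDiagGL hϖ.ne_zero (fun _ : Fin n => (N : ℤ)) * g :
      GL (Fin n) F) : Matrix (Fin n) (Fin n) F) := by
  choose N hN using fun p : Fin n × Fin n => exists_pow_mul_mem hϖ ((g : Matrix (Fin n) (Fin n) F) p.1 p.2)
  refine ⟨∑ p, N p, fun i j => ?_⟩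
  rw [zpowDiagGL_const_mul_apply, zpow_natCast]
  exact hN (i, j) _ (Finset.single_le_sum (fun p _ => Nat.zero_le (N p)) (Finset.mem_univ (i, j)))

end Scaling

/-! ### The Cartan decomposition -/

section Cartan

variable [IsDiscreteValuationRing 𝒪[F]] {ϖ : F} (hϖ : IsUniformizingElement ϖ)
include hϖ

omit [ValuativeRel F] [IsDiscreteValuationRing 𝒪[F]] hϖ in
/-- Conjugating `ϖ^a` by a permutation matrix permutes the exponents:
`P_σ ϖ^a P_σ⁻¹ = ϖ^{a ∘ σ}`. [folklore] -/
theorem permGL_mul_piPowGL_mul_inv (hϖ0 : ϖ ≠ 0) (σ : Equiv.Perm (Fin n)) (a : Fin n → ℕ) :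
    (permGL σ : GL (Fin n) F) * piPowGL hϖ0 a * (permGL σ)⁻¹ = piPowGL hϖ0 (a ∘ σ) := by
  rw [mul_inv_eq_iff_eq_mul]
  refine Units.ext ?_
  rw [Units.val_mul, Units.val_mul, coe_permGL, coe_piPowGL, coe_piPowGL]
  unfold Echelon.piPow
  rw [permMatrix_mul_diagonal]
  rfl

omit [IsDiscreteValuationRing 𝒪[F]] hϖ in
/-- Sorting the exponents of a diagonal representative by conjugating with a permutation matrix
(which lies in `K`). [folklore] -/
theorem exists_glInt_mul_mul_eq_piPowGL_of_exists (hϖ0 : ϖ ≠ 0) {g : GL (Fin n) F}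
    (h : ∃ k₁ ∈ glInt n F, ∃ k₂ ∈ glInt n F, ∃ m : Fin n → ℕ, k₁ * g * k₂ = piPowGL hϖ0 m) :
    ∃ k₁ ∈ glInt n F, ∃ k₂ ∈ glInt n F, ∃ a : Fin n → ℕ, Antitone a ∧
      k₁ * g * k₂ = piPowGL hϖ0 a := by
  obtain ⟨k₁, hk₁, k₂, hk₂, m, hm⟩ := h
  -- `Tuple.sort m` sorts `m` increasingly; reversing gives a decreasing arrangement
  set σ : Equiv.Perm (Fin n) := Fin.revPerm.trans (Tuple.sort m) with hσ
  have hanti : Antitone (m ∘ σ) := by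
    intro i j hij
    have hmono := Tuple.monotone_sort m
    change m ((Tuple.sort m) (Fin.rev j)) ≤ m ((Tuple.sort m) (Fin.rev i))
    exact hmono (Fin.rev_le_rev.mpr hij)
  refine ⟨permGL σ * k₁, Subgroup.mul_mem _ (permGL_mem_glInt σ) hk₁, k₂ * (permGL σ)⁻¹,
    Subgroup.mul_mem _ hk₂ (Subgroup.inv_mem _ (permGL_mem_glInt σ)), m ∘ σ, hanti, ?_⟩
  rw [← permGL_mul_piPowGL_mul_inv hϖ0 σ m, ← hm]
  group

/-- **Cartan decomposition of `GL_n(F)`, integral form** (elementary divisors): for an integral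
invertible matrix `g` there are `k₁, k₂ ∈ K = GL_n(𝒪)` and exponents
`a_1 ≥ a_2 ≥ ⋯ ≥ a_n ≥ 0` with `k₁ g k₂ = diag(ϖ^{a_1}, …, ϖ^{a_n})`; i.e. the double cosets
`K g K` of integral matrices are represented by the anti-dominant-sorted powers of `ϖ`
(Smith normal form over the discrete valuation ring `𝒪`; Bump (1997), Prop. 4.6.2 and proof of
Thm. 3.3.3; Cartier, Corvallis 1979, §IV.2, Example; Shimura (1971), Lemma 3.12/§3.2).
[cite: CartierCorvallis1979, §IV.2] -/
theorem exists_glInt_mul_mul_eq_piPowGL {g : GL (Fin n) F}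
    (hg : IsIntegralMatrix (g : Matrix (Fin n) (Fin n) F)) :
    ∃ k₁ ∈ glInt n F, ∃ k₂ ∈ glInt n F, ∃ a : Fin n → ℕ, Antitone a ∧
      k₁ * g * k₂ = piPowGL hϖ.ne_zero a := by
  classical
  -- integral model `Y` of `g`
  obtain ⟨Y, hY⟩ := hg.exists_map
  set f : 𝒪[F] →+* F := (𝒪[F]).subtype with hf
  have hYinj : Function.Injective Y.mulVec := by
    intro u w huw
    have h' : (Y.map f) *ᵥ (f ∘ u) = (Y.map f) *ᵥ (f ∘ w) := by
      funext i
      rw [← RingHom.map_mulVec, ← RingHom.map_mulVec, huw]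
    rw [hY] at h'
    have := Matrix.mulVec_injective_iff_isUnit.mpr (Units.isUnit g) h'
    funext i
    exact Subtype.val_injective (congrFun this i)
  obtain ⟨B, C, a, ⟨uB, rfl⟩, ⟨uC, rfl⟩, hYBC⟩ :=
    Matrix.exists_eq_mul_diagonal_mul_of_mulVec_injective Y hYinj
  -- the entries `a i` are non-zero: `det Y ≠ 0`
  have hdetY : Y.det ≠ 0 := by
    intro h0
    have h1 : (g : Matrix (Fin n) (Fin n) F).det = 0 := by
      rw [← hY, ← RingHom.mapMatrix_apply, ← RingHom.map_det, h0, map_zero]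
    exact (Matrix.GeneralLinearGroup.det g).ne_zero (by
      rw [Matrix.GeneralLinearGroup.val_det_apply]; exact h1)
  have ha0 : ∀ i, a i ≠ 0 := by
    intro i h0
    apply hdetY
    rw [hYBC, Matrix.det_mul, Matrix.det_mul, Matrix.det_diagonal,
      Finset.prod_eq_zero (Finset.mem_univ i) h0, mul_zero, zero_mul]
  -- `a i = u i * ϖ ^ m i`
  have hirr : Irreducible (⟨ϖ, hϖ.mem⟩ : 𝒪[F]) :=
    (IsDiscreteValuationRing.irreducible_iff_uniformizer _).mpr hϖ.span_eq
  choose m u hmu using fun i => IsDiscreteValuationRing.eq_unit_mul_pow_irreducible (ha0 i) hirr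
  -- the unit diagonal part, in `K`
  have hval : ∀ i, valuation F (((u i : 𝒪[F]) : F)) = 1 := fun i =>
    (Valuation.integer.integers (valuation F)).isUnit_iff_valuation_eq_one.mp (u i).isUnit
  have hu0 : ∀ i, ((u i : 𝒪[F]) : F) ≠ 0 := by
    intro i h; have := hval i; rw [h, map_zero] at this; exact zero_ne_one this
  set e : Fin n → Fˣ := fun i => Units.mk0 _ (hu0 i) with he
  have heK : diagonalGL (Fin n) F e ∈ glInt n F := diagonalGL_mem_glInt fun i => hval i
  -- the two unimodular factors, in `K`
  set kB : GL (Fin n) F := Matrix.GeneralLinearGroup.map f uB with hkB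
  set kC : GL (Fin n) F := Matrix.GeneralLinearGroup.map f uC with hkC
  have hkBK : kB ∈ glInt n F := ⟨uB, rfl⟩
  have hkCK : kC ∈ glInt n F := ⟨uC, rfl⟩
  -- `g = kB · diag(e) · ϖ^m · kC`
  have hg_eq : g = kB * (diagonalGL (Fin n) F e * piPowGL hϖ.ne_zero m) * kC := by
    refine Units.ext ?_
    have hdiag : (Matrix.diagonal a).map f = Matrix.diagonal (fun i => (e i : F) * ϖ ^ m i) := by
      rw [Matrix.diagonal_map (map_zero f)]
      congr 1
      funext i
      rw [hmu i, map_mul, map_pow]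
      rfl
    calc (g : Matrix (Fin n) (Fin n) F) = Y.map f := hY.symm
      _ = (uB : Matrix (Fin n) (Fin n) 𝒪[F]).map f * (Matrix.diagonal a).map f *
            (uC : Matrix (Fin n) (Fin n) 𝒪[F]).map f := by
          rw [hYBC, Matrix.map_mul, Matrix.map_mul]
      _ = _ := by
          rw [hdiag, Units.val_mul, Units.val_mul, Units.val_mul, coe_diagonalGL, coe_piPowGL]
          unfold Echelon.piPow
          rw [Matrix.diagonal_mul_diagonal]
          rfl
  refine exists_glInt_mul_mul_eq_piPowGL_of_exists hϖ.ne_zero ?_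
  refine ⟨(diagonalGL (Fin n) F e)⁻¹ * kB⁻¹, Subgroup.mul_mem _ (Subgroup.inv_mem _ heK)
    (Subgroup.inv_mem _ hkBK), kC⁻¹, Subgroup.inv_mem _ hkCK, m, ?_⟩
  rw [hg_eq]; group

/-- **Cartan decomposition of `GL_n(F)`** (general form): every `g ∈ GL_n(F)` satisfies
`k₁ g k₂ = diag(ϖ^{a_1}, …, ϖ^{a_n})` for some `k₁, k₂ ∈ GL_n(𝒪)` and integers
`a_1 ≥ ⋯ ≥ a_n`, i.e. `GL_n(F) = ⨆_a K ϖ^a K` over anti-dominant-sorted `a ∈ ℤⁿ` (Cartier,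
Corvallis 1979, §IV.2, Example, the Cartan decomposition `G = K A⁻ K` for `GL_n`; Bump (1997),
Prop. 4.6.2). [cite: CartierCorvallis1979, §IV.2] -/
theorem exists_glInt_mul_mul_eq_zpowDiagGL (g : GL (Fin n) F) :
    ∃ k₁ ∈ glInt n F, ∃ k₂ ∈ glInt n F, ∃ a : Fin n → ℤ, Antitone a ∧
      k₁ * g * k₂ = zpowDiagGL hϖ.ne_zero a := by
  obtain ⟨N, hN⟩ := exists_zpowDiagGL_mul_isIntegralMatrix hϖ g
  obtain ⟨k₁, hk₁, k₂, hk₂, a, ha, h⟩ := exists_glInt_mul_mul_eq_piPowGL hϖ hN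
  refine ⟨k₁, hk₁, k₂, hk₂, fun i => (a i : ℤ) - N, fun i j hij => by
    have := ha hij; simp only; omega, ?_⟩
  have hz : zpowDiagGL hϖ.ne_zero (fun i => (a i : ℤ) - N) =
      zpowDiagGL hϖ.ne_zero (-fun _ : Fin n => (N : ℤ)) * piPowGL hϖ.ne_zero a := by
    rw [← zpowDiagGL_natCast, ← zpowDiagGL_add]
    congr 1
    funext i
    simp only [Pi.add_apply, Pi.neg_apply]
    ring
  rw [hz, zpowDiagGL_neg, ← h, ← mul_assoc k₁, mul_zpowDiagGL_const_comm hϖ.ne_zero (N : ℤ) k₁]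
  group

omit [IsDiscreteValuationRing 𝒪[F]] in
/-- `ϖ^a ∈ Δ_{∑ a}`: `diag(ϖ^{a_i})` is integral with `|det| = |ϖ|^{∑ a_i}`. [folklore] -/
theorem piPowGL_mem_glIntDet (a : Fin n → ℕ) : piPowGL hϖ.ne_zero a ∈ glIntDet n ϖ (∑ i, a i) := by
  refine ⟨?_, ?_⟩
  · rw [coe_piPowGL]
    exact isIntegralMatrix_piPow hϖ.mem a
  · rw [coe_piPowGL, Echelon.det_piPow, map_pow]

omit [IsDiscreteValuationRing 𝒪[F]] in
/-- `m ↦ |ϖ|^m` is injective. [folklore] -/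
theorem valuation_pow_injective : Function.Injective fun m : ℕ => valuation F ϖ ^ m := by
  intro a b h
  by_contra hab
  rcases Nat.lt_or_gt_of_ne hab with hlt | hlt
  · exact absurd h (pow_lt_pow_right_of_lt_one₀ ((Valuation.pos_iff _).mpr hϖ.ne_zero)
      hϖ.valuation_lt_one hlt).ne'
  · exact absurd h (pow_lt_pow_right_of_lt_one₀ ((Valuation.pos_iff _).mpr hϖ.ne_zero)
      hϖ.valuation_lt_one hlt).ne

omit [IsDiscreteValuationRing 𝒪[F]] in
/-- If `ϖ^a ∈ Δ_m` then `∑ a_i = m`. [folklore] -/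
theorem sum_eq_of_piPowGL_mem_glIntDet {a : Fin n → ℕ} {m : ℕ}
    (h : piPowGL hϖ.ne_zero a ∈ glIntDet n ϖ m) : ∑ i, a i = m := by
  apply valuation_pow_injective hϖ
  have h1 := h.2
  rw [coe_piPowGL, Echelon.det_piPow, map_pow] at h1
  exact h1

/-- **The double cosets in `Δ_m`**: every `g ∈ Δ_m` (integral, `|det g| = |ϖ|^m`) satisfies
`k₁ g k₂ = ϖ^a` with `k₁, k₂ ∈ K`, `a` antitone and `∑ a_i = m` — the double cosets
`K g K ⊆ Δ_m` are among the `K ϖ^a K`, `a_1 ≥ ⋯ ≥ a_n ≥ 0`, `|a| = m` (Shimura (1971), §3.2;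
Macdonald, Ch. V, (2.2)). [cite: ShimuraIATAF1971, §3.2] -/
theorem exists_glInt_mul_mul_eq_piPowGL_of_mem_glIntDet {g : GL (Fin n) F} {m : ℕ}
    (hg : g ∈ glIntDet n ϖ m) :
    ∃ k₁ ∈ glInt n F, ∃ k₂ ∈ glInt n F, ∃ a : Fin n → ℕ, Antitone a ∧ ∑ i, a i = m ∧
      k₁ * g * k₂ = piPowGL hϖ.ne_zero a := by
  obtain ⟨k₁, hk₁, k₂, hk₂, a, ha, h⟩ := exists_glInt_mul_mul_eq_piPowGL hϖ hg.1
  refine ⟨k₁, hk₁, k₂, hk₂, a, ha, sum_eq_of_piPowGL_mem_glIntDet hϖ ?_, h⟩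
  rw [← h, mul_assoc]
  exact (glInt_mul_mem_glIntDet_iff hk₁).2 ((mul_glInt_mem_glIntDet_iff hk₂).2 hg)

end Cartan

end Literature.NumberTheory.Automorphic
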